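import Summits.QuantumFields.GaugeBoot.BootstrapGroupAutomorphisms
import Summits.QuantumFields.GaugeBoot.GaugeInvariantBootstrap
import HarnessLib

/-!
# Internal symmetries of the bootstrap II: charge conjugation, "Wilson loops are real" (gauge-boot, L1 supplement)

HONEST FRAMING (cell `pub-gaugeboot`, page 1 of every file): the venture produces certified bounds
on lattice expectations at stated coupling, gauge group, dimension and torus size; NOT a mass gap,
NOT a continuum limit, NOT a string tension; NOT Yang–Mills-summit-bearing (barriers
`FixedCouplingUltralocality`, `PerturbativeInvisibility`). Structural; it certifies no number.

## Content

Charge conjugation `U ↦ Ū` (entrywise complex conjugation of every link matrix) is a continuous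
involutive automorphism of `SU(N)` and of `U(N)` (`chargeConjSU` — the same map as the tree's `chargeConjSU` of
`CPeriodicBoundaryConditions`, restated here to keep the import closure light —, `chargeConjU`) which preserves `Re tr`, maps the
exponential family `e^{tX}` to `e^{tX̄}` (`X̄ ∈ 𝔰𝔲(N)` resp. `𝔲(N)`: `conjGenSU`, `conjGenU`;
`chargeConjSU_suExp`) and sends the coordinate generators to `±` themselves. By
`BootstrapGroupAutomorphisms`:

* ★★ `IsSDFunctional.comp_conj_suN` / `_uN` — the loop equations are covariant under charge
  conjugation;
* ★★★ `bootstrap_conjInvariant_suN` / `_uN` — every solution of the untruncated bootstrap is charge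
  conjugation invariant on the polynomial observables, at every real `β`;
* `loopIm_comp_conj` — `Im tr ρ(hol_x(w)(Ū)) = -Im tr ρ(hol_x(w)(U))`; hence ★★★ `wilson_loopIm_eq_zero`
  (THE WILSON LOOP EXPECTATIONS ARE REAL: `∫ Im tr hol_x(w) dμ_Wilson = 0` for every lattice word, any
  `β`, `d`, `L`), ★★★ `loopIm_eq_zero_of_bootstrap_suN` (every solution assigns `0` to every
  `Im tr hol`), and `loopIm_eq_zero_of_gaugeInvariantBootstrap_suN` (the same for the bootstrap on
  gauge-invariant data, closed words) — the reality constraint `W[C] ∈ ℝ`, `W[C̄] = W[C]` imposed by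
  every lattice bootstrap is a CONSEQUENCE of the untruncated constraints and costs nothing.

References: V. Kazakov, Z. Zheng, arXiv:2203.11360 §3.2; P. Anderson, M. Kruczenski, Nucl. Phys. B
921 (2017) §3. Folklore.
-/

noncomputable section

open MeasureTheory Filter Topology NormedSpace
open scoped Matrix ComplexConjugate
open Literature.MathematicalPhysics.QuantumFieldTheory (LatticeRep Site Edge GaugeConfig IsGaugeInvariant wilsonAction
  wilsonMeasure isProbabilityMeasure_wilsonMeasure)

namespace Summit.QuantumFields.GaugeBoot

/-! ## Entrywise complex conjugation of unitary matrices -/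

section Matrices

variable {N : ℕ}

/-- Entrywise conjugation is `(·ᴴ)ᵀ`. -/
theorem map_conj_eq_conjTranspose_transpose (M : Matrix (Fin N) (Fin N) ℂ) :
    M.map (starRingEnd ℂ) = (Mᴴ)ᵀ := by
  ext i j; simp

/-- Entrywise conjugation preserves unitarity. -/
theorem map_conj_mem_unitaryGroup {M : Matrix (Fin N) (Fin N) ℂ} (hM : M ∈ Matrix.unitaryGroup (Fin N) ℂ) :
    M.map (starRingEnd ℂ) ∈ Matrix.unitaryGroup (Fin N) ℂ := by
  rw [Matrix.mem_unitaryGroup_iff'] at hM ⊢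
  rw [Matrix.star_eq_conjTranspose, ← Matrix.conjTranspose_map (starRingEnd ℂ) (fun z => by simp),
    ← Matrix.map_mul, ← Matrix.star_eq_conjTranspose, hM]
  simp

/-- Entrywise conjugation conjugates the trace. -/
theorem trace_map_conj (M : Matrix (Fin N) (Fin N) ℂ) : (M.map (starRingEnd ℂ)).trace = starRingEnd ℂ M.trace := by
  simp [Matrix.trace, map_sum]

/-- `Im tr M̄ = -Im tr M`. -/
theorem trace_map_conj_im (M : Matrix (Fin N) (Fin N) ℂ) : (M.map (starRingEnd ℂ)).trace.im = -M.trace.im := by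
  rw [trace_map_conj, Complex.conj_im]

/-- **Conjugation commutes with the exponential family**: `conj (e^{tX}) = e^{t X̄}` for real `t`. -/
theorem map_conj_exp_smul (X : Matrix (Fin N) (Fin N) ℂ) (t : ℝ) :
    (exp ((t : ℂ) • X)).map (starRingEnd ℂ) = exp ((t : ℂ) • X.map (starRingEnd ℂ)) := by
  rw [map_conj_eq_conjTranspose_transpose, map_conj_eq_conjTranspose_transpose, ← Matrix.exp_conjTranspose,
    ← Matrix.exp_transpose, Matrix.conjTranspose_smul, Matrix.transpose_smul]
  congr 2
  rw [Complex.star_def, Complex.conj_ofReal]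

/-- Conjugation preserves skew-Hermitian matrices. -/
theorem star_map_conj_of_skew {X : Matrix (Fin N) (Fin N) ℂ} (hX : star X = -X) :
    star (X.map (starRingEnd ℂ)) = -X.map (starRingEnd ℂ) := by
  rw [Matrix.star_eq_conjTranspose, ← Matrix.conjTranspose_map (starRingEnd ℂ) (fun z => by simp),
    ← Matrix.star_eq_conjTranspose, hX, Matrix.map_neg _ (map_neg _)]

end Matrices

/-! ## Charge conjugation on `SU(N)` and `U(N)` -/

section Groups

open Literature.MathematicalPhysics.QuantumLattice

variable (N : ℕ)

/-- **Charge conjugation on `U(N)`**: `U ↦ Ū`, a continuous involutive automorphism. [folklore] -/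
def chargeConjU : Matrix.unitaryGroup (Fin N) ℂ →* Matrix.unitaryGroup (Fin N) ℂ where
  toFun g := ⟨(g : Matrix (Fin N) (Fin N) ℂ).map (starRingEnd ℂ), map_conj_mem_unitaryGroup g.2⟩
  map_one' := Subtype.ext (by simp)
  map_mul' g h := Subtype.ext (by simp [Matrix.map_mul])

/-- **Charge conjugation on `SU(N)`**: `U ↦ Ū` (`det Ū = conj det U = 1`; the tree's `suConj` of
`CPeriodicBoundaryConditions`). [folklore] -/
def chargeConjSU : Matrix.specialUnitaryGroup (Fin N) ℂ →* Matrix.specialUnitaryGroup (Fin N) ℂ where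
  toFun g := ⟨(g : Matrix (Fin N) (Fin N) ℂ).map (starRingEnd ℂ), Matrix.mem_specialUnitaryGroup_iff.2
    ⟨map_conj_mem_unitaryGroup (Matrix.mem_specialUnitaryGroup_iff.1 g.2).1, by
      rw [← RingHom.mapMatrix_apply, ← RingHom.map_det, (Matrix.mem_specialUnitaryGroup_iff.1 g.2).2, map_one]⟩⟩
  map_one' := Subtype.ext (by simp)
  map_mul' g h := Subtype.ext (by simp [Matrix.map_mul])

/-- `chargeConjSU` on matrices. -/
@[simp] theorem coe_chargeConjSU (g : Matrix.specialUnitaryGroup (Fin N) ℂ) :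
    ((chargeConjSU N g : Matrix.specialUnitaryGroup (Fin N) ℂ) : Matrix (Fin N) (Fin N) ℂ) =
      (g : Matrix (Fin N) (Fin N) ℂ).map (starRingEnd ℂ) := rfl

/-- `chargeConjU` on matrices. -/
@[simp] theorem coe_chargeConjU (g : Matrix.unitaryGroup (Fin N) ℂ) :
    ((chargeConjU N g : Matrix.unitaryGroup (Fin N) ℂ) : Matrix (Fin N) (Fin N) ℂ) = (g : Matrix (Fin N) (Fin N) ℂ).map (starRingEnd ℂ) := rfl

/-- Continuity of `chargeConjU`. -/
theorem continuous_chargeConjU : Continuous (chargeConjU N) :=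
  continuous_induced_rng.2 (continuous_subtype_val.matrix_map Complex.continuous_conj)

/-- Continuity of `chargeConjSU`. -/
theorem continuous_chargeConjSU : Continuous (chargeConjSU N) :=
  continuous_induced_rng.2 (continuous_subtype_val.matrix_map Complex.continuous_conj)

/-- `chargeConjU` is an involution. -/
theorem chargeConjU_involutive : Function.Involutive (chargeConjU N) := fun g =>
  Subtype.ext (by ext i j; simp)

/-- `chargeConjSU` is an involution. -/
theorem chargeConjSU_involutive : Function.Involutive (chargeConjSU N) := fun g =>
  Subtype.ext (by ext i j; simp)

/-- **Conjugate generator** in `𝔲(N)`. [folklore] -/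
def conjGenU (X : UGenerator N) : UGenerator N :=
  ⟨(X : Matrix (Fin N) (Fin N) ℂ).map (starRingEnd ℂ),
    skewAdjoint.mem_iff.2 (star_map_conj_of_skew (skewAdjoint.mem_iff.1 X.2))⟩

/-- **Conjugate generator** in `𝔰𝔲(N)`. [folklore] -/
def conjGenSU (X : SuGenerator N) : SuGenerator N :=
  ⟨(X : Matrix (Fin N) (Fin N) ℂ).map (starRingEnd ℂ),
    skewAdjoint.mem_iff.2 (star_map_conj_of_skew (skewAdjoint.mem_iff.1 X.2.1)),
    by rw [trace_map_conj, X.2.2, map_zero]⟩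

/-- `conjGenU` is an involution. -/
theorem conjGenU_conjGenU (X : UGenerator N) : conjGenU N (conjGenU N X) = X :=
  Subtype.ext (by ext i j; simp [conjGenU])

/-- `conjGenSU` is an involution. -/
theorem conjGenSU_conjGenSU (X : SuGenerator N) : conjGenSU N (conjGenSU N X) = X :=
  Subtype.ext (by ext i j; simp [conjGenSU])

/-- **Charge conjugation permutes the exponential families of `U(N)`**: `conj e^{tX} = e^{t X̄}`. -/
theorem chargeConjU_uExp (X : UGenerator N) (t : ℝ) : chargeConjU N (uExp N X t) = uExp N (conjGenU N X) t :=
  Subtype.ext (by simp only [coe_chargeConjU, coe_uExp, conjGenU]; exact map_conj_exp_smul _ t)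

/-- **Charge conjugation permutes the exponential families of `SU(N)`.** -/
theorem chargeConjSU_suExp (X : SuGenerator N) (t : ℝ) : chargeConjSU N (suExp N X t) = suExp N (conjGenSU N X) t :=
  Subtype.ext (by simp only [coe_chargeConjSU, coe_suExp, conjGenSU]; exact map_conj_exp_smul _ t)

/-- `Re tr` is invariant under `chargeConjU`. -/
theorem trace_re_chargeConjU (g : Matrix.unitaryGroup (Fin N) ℂ) :
    (unitaryFundamentalRep (Fin N) ℂ (chargeConjU N g)).trace.re = (unitaryFundamentalRep (Fin N) ℂ g).trace.re := by
  change (((g : Matrix (Fin N) (Fin N) ℂ).map (starRingEnd ℂ))).trace.re = (g : Matrix (Fin N) (Fin N) ℂ).trace.re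
  rw [trace_map_conj, Complex.conj_re]

/-- `Re tr` is invariant under `chargeConjSU`. -/
theorem trace_re_chargeConjSU (g : Matrix.specialUnitaryGroup (Fin N) ℂ) :
    (fundamentalRep (Fin N) (chargeConjSU N g)).trace.re = (fundamentalRep (Fin N) g).trace.re := by
  change (((g : Matrix (Fin N) (Fin N) ℂ).map (starRingEnd ℂ))).trace.re = (g : Matrix (Fin N) (Fin N) ℂ).trace.re
  rw [trace_map_conj, Complex.conj_re]

variable {ι : Type*}

/-- The coordinate generators under `chargeConjU`: `Re ↦ Re`, `Im ↦ -Im`. -/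
theorem entry_comp_chargeConjU (e : ι) (a b : Fin N) :
    (reEntry (unitaryFundamentalLatticeRep N) e a b).comp (autCM (ι := ι) (chargeConjU N) (continuous_chargeConjU N)) =
        reEntry (unitaryFundamentalLatticeRep N) e a b ∧
      (imEntry (unitaryFundamentalLatticeRep N) e a b).comp (autCM (ι := ι) (chargeConjU N) (continuous_chargeConjU N)) =
        -imEntry (unitaryFundamentalLatticeRep N) e a b := by
  constructor
  · ext U; simp [unitaryFundamentalLatticeRep_ρ]; rfl
  · ext U; simp [unitaryFundamentalLatticeRep_ρ]; rfl

/-- The coordinate generators under `chargeConjSU`. -/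
theorem entry_comp_chargeConjSU (e : ι) (a b : Fin N) :
    (reEntry (fundamentalLatticeRep N) e a b).comp (autCM (ι := ι) (chargeConjSU N) (continuous_chargeConjSU N)) =
        reEntry (fundamentalLatticeRep N) e a b ∧
      (imEntry (fundamentalLatticeRep N) e a b).comp (autCM (ι := ι) (chargeConjSU N) (continuous_chargeConjSU N)) =
        -imEntry (fundamentalLatticeRep N) e a b := by
  constructor
  · ext U; simp [fundamentalLatticeRep_ρ]; rfl
  · ext U; simp [fundamentalLatticeRep_ρ]; rfl

/-- Generator stability under `chargeConjU`. -/
theorem hgen_chargeConjU (e : ι) (a b : Fin N) :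
    (reEntry (unitaryFundamentalLatticeRep N) e a b).comp (autCM (ι := ι) (chargeConjU N) (continuous_chargeConjU N)) ∈
        polyAlgebra (ι := ι) (unitaryFundamentalLatticeRep N) ∧
      (imEntry (unitaryFundamentalLatticeRep N) e a b).comp (autCM (ι := ι) (chargeConjU N) (continuous_chargeConjU N)) ∈
        polyAlgebra (ι := ι) (unitaryFundamentalLatticeRep N) := by
  rw [(entry_comp_chargeConjU N e a b).1, (entry_comp_chargeConjU N e a b).2]
  exact ⟨reEntry_mem (ι := ι) (unitaryFundamentalLatticeRep N) e a b,
    Subalgebra.neg_mem _ (imEntry_mem (ι := ι) (unitaryFundamentalLatticeRep N) e a b)⟩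

/-- Generator stability under `chargeConjSU`. -/
theorem hgen_chargeConjSU (e : ι) (a b : Fin N) :
    (reEntry (fundamentalLatticeRep N) e a b).comp (autCM (ι := ι) (chargeConjSU N) (continuous_chargeConjSU N)) ∈
        polyAlgebra (ι := ι) (fundamentalLatticeRep N) ∧
      (imEntry (fundamentalLatticeRep N) e a b).comp (autCM (ι := ι) (chargeConjSU N) (continuous_chargeConjSU N)) ∈
        polyAlgebra (ι := ι) (fundamentalLatticeRep N) := by
  rw [(entry_comp_chargeConjSU N e a b).1, (entry_comp_chargeConjSU N e a b).2]
  exact ⟨reEntry_mem (ι := ι) (fundamentalLatticeRep N) e a b,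
    Subalgebra.neg_mem _ (imEntry_mem (ι := ι) (fundamentalLatticeRep N) e a b)⟩

end Groups

/-! ## The bootstrap under charge conjugation -/

section Bootstrap

open Literature.MathematicalPhysics.QuantumLattice

variable {d L : ℕ} [NeZero L] (N : ℕ) (β : ℝ)

/-- ★★ **`SU(N)`: the loop equations are covariant under charge conjugation.** [folklore] -/
theorem IsSDFunctional.comp_conj_suN {φ : C(GaugeConfig d L (Matrix.specialUnitaryGroup (Fin N) ℂ), ℝ) →ₗ[ℝ] ℝ}
    (hφ : IsSDFunctional (fundamentalLatticeRep N) (suExp N) (fun _ => wilsonAction (fundamentalRep (Fin N))) β φ) :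
    IsSDFunctional (fundamentalLatticeRep N) (suExp N) (fun _ => wilsonAction (fundamentalRep (Fin N))) β
      (φ ∘ₗ (ContinuousMap.compRightAlgHom ℝ ℝ
        (autCM (ι := Edge d L) (chargeConjSU N) (continuous_chargeConjSU N))).toLinearMap) :=
  hφ.comp_aut (chargeConjSU N) (continuous_chargeConjSU N) (fundamentalLatticeRep N) (conjGenSU N) (conjGenSU_conjGenSU N)
    (chargeConjSU_suExp N) (fun _ U => wilsonAction_comp_aut (chargeConjSU N) (fundamentalRep (Fin N)) (trace_re_chargeConjSU N) U)
    (hgen_chargeConjSU N)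

/-- ★★ **`U(N)`: the loop equations are covariant under charge conjugation.** [folklore] -/
theorem IsSDFunctional.comp_conj_uN {φ : C(GaugeConfig d L (Matrix.unitaryGroup (Fin N) ℂ), ℝ) →ₗ[ℝ] ℝ}
    (hφ : IsSDFunctional (unitaryFundamentalLatticeRep N) (uExp N)
      (fun _ => wilsonAction (unitaryFundamentalRep (Fin N) ℂ)) β φ) :
    IsSDFunctional (unitaryFundamentalLatticeRep N) (uExp N) (fun _ => wilsonAction (unitaryFundamentalRep (Fin N) ℂ)) β
      (φ ∘ₗ (ContinuousMap.compRightAlgHom ℝ ℝ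
        (autCM (ι := Edge d L) (chargeConjU N) (continuous_chargeConjU N))).toLinearMap) :=
  hφ.comp_aut (chargeConjU N) (continuous_chargeConjU N) (unitaryFundamentalLatticeRep N) (conjGenU N) (conjGenU_conjGenU N)
    (chargeConjU_uExp N) (fun _ U => wilsonAction_comp_aut (chargeConjU N) (unitaryFundamentalRep (Fin N) ℂ) (trace_re_chargeConjU N) U)
    (hgen_chargeConjU N)

/-- ★★★ **`SU(N)`: every solution of the untruncated bootstrap is charge conjugation invariant.**
[folklore] -/
theorem bootstrap_conjInvariant_suN {φ : C(GaugeConfig d L (Matrix.specialUnitaryGroup (Fin N) ℂ), ℝ) →ₗ[ℝ] ℝ}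
    (h1 : φ 1 = 1) (hpos : ∀ a ∈ polyAlgebra (ι := Edge d L) (fundamentalLatticeRep N), 0 ≤ φ (a * a))
    (hφ : IsSDFunctional (fundamentalLatticeRep N) (suExp N) (fun _ => wilsonAction (fundamentalRep (Fin N))) β φ)
    {f : C(GaugeConfig d L (Matrix.specialUnitaryGroup (Fin N) ℂ), ℝ)}
    (hf : f ∈ polyAlgebra (ι := Edge d L) (fundamentalLatticeRep N)) :
    φ (f.comp (autCM (ι := Edge d L) (chargeConjSU N) (continuous_chargeConjSU N))) = φ f :=
  bootstrap_autInvariant_suN N β (chargeConjSU N) (continuous_chargeConjSU N) (chargeConjSU_involutive N) (trace_re_chargeConjSU N)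
    (hgen_chargeConjSU N) h1 hpos hφ hf

/-- ★★★ **`U(N)`: every solution of the untruncated bootstrap is charge conjugation invariant.**
[folklore] -/
theorem bootstrap_conjInvariant_uN {φ : C(GaugeConfig d L (Matrix.unitaryGroup (Fin N) ℂ), ℝ) →ₗ[ℝ] ℝ}
    (h1 : φ 1 = 1) (hpos : ∀ a ∈ polyAlgebra (ι := Edge d L) (unitaryFundamentalLatticeRep N), 0 ≤ φ (a * a))
    (hφ : IsSDFunctional (unitaryFundamentalLatticeRep N) (uExp N)
      (fun _ => wilsonAction (unitaryFundamentalRep (Fin N) ℂ)) β φ)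
    {f : C(GaugeConfig d L (Matrix.unitaryGroup (Fin N) ℂ), ℝ)}
    (hf : f ∈ polyAlgebra (ι := Edge d L) (unitaryFundamentalLatticeRep N)) :
    φ (f.comp (autCM (ι := Edge d L) (chargeConjU N) (continuous_chargeConjU N))) = φ f :=
  bootstrap_autInvariant_uN N β (chargeConjU N) (continuous_chargeConjU N) (chargeConjU_involutive N) (trace_re_chargeConjU N)
    (hgen_chargeConjU N) h1 hpos hφ hf

/-! ### Wilson loops are real -/

omit [NeZero L] in
/-- **`Im tr hol` flips sign under charge conjugation** (`SU(N)`). -/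
theorem loopIm_comp_chargeConjSU (x : Site d L) (w : Word d) :
    (loopIm (fundamentalLatticeRep N) x w).comp (autCM (ι := Edge d L) (chargeConjSU N) (continuous_chargeConjSU N)) =
      -loopIm (fundamentalLatticeRep N) x w := by
  ext U
  simp only [ContinuousMap.comp_apply, ContinuousMap.neg_apply, loopIm_apply, coe_autCM, wordHolonomy_comp_aut,
    fundamentalLatticeRep_ρ]
  exact trace_map_conj_im _

/-- ★★★ **The Wilson loop expectations of `SU(N)` lattice gauge theory are REAL**:
`∫ Im tr hol_x(w) dμ_Wilson = 0` for every lattice word `w`, every real `β`, every `d`, `L`. [folklore] -/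
theorem wilson_loopIm_eq_zero_suN (x : Site d L) (w : Word d) :
    ∫ U, loopIm (fundamentalLatticeRep N) x w U ∂(wilsonMeasure (d := d) (L := L) (fundamentalRep (Fin N)) β) = 0 := by
  have h := integral_comp_aut_eq_wilson (d := d) (L := L) (chargeConjSU N) (fundamentalRep (Fin N)) (continuous_chargeConjSU N)
    (chargeConjSU_involutive N) (trace_re_chargeConjSU N) β (loopIm (fundamentalLatticeRep N) x w)
  have h2 : ∀ U : GaugeConfig d L (Matrix.specialUnitaryGroup (Fin N) ℂ),
      loopIm (fundamentalLatticeRep N) x w (chargeConjSU N ∘ U) = -loopIm (fundamentalLatticeRep N) x w U := fun U => by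
    have := congrFun (congrArg DFunLike.coe (loopIm_comp_chargeConjSU (d := d) (L := L) N x w)) U
    exact this
  simp_rw [h2, integral_neg] at h
  linarith

/-- ★★★ **Every solution of the `SU(N)` bootstrap assigns `0` to every `Im tr hol_x(w)`** (the reality
constraint `W[C] ∈ ℝ` / `W[C̄] = W[C]` is a consequence of the untruncated constraints). [folklore] -/
theorem loopIm_eq_zero_of_bootstrap_suN {φ : C(GaugeConfig d L (Matrix.specialUnitaryGroup (Fin N) ℂ), ℝ) →ₗ[ℝ] ℝ}
    (h1 : φ 1 = 1) (hpos : ∀ a ∈ polyAlgebra (ι := Edge d L) (fundamentalLatticeRep N), 0 ≤ φ (a * a))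
    (hφ : IsSDFunctional (fundamentalLatticeRep N) (suExp N) (fun _ => wilsonAction (fundamentalRep (Fin N))) β φ)
    (x : Site d L) (w : Word d) : φ (loopIm (fundamentalLatticeRep N) x w) = 0 := by
  rw [eq_wilson_of_bootstrap_suN N β h1 hpos hφ (loopIm_mem _ x w), wilson_loopIm_eq_zero_suN]

/-- ★★★ **The bootstrap on gauge-invariant data assigns `0` to every `Im tr` of a CLOSED loop** (`SU(N)`;
loop positivity + gauge-averaged loop equations + normalisation). [folklore] -/
theorem loopIm_eq_zero_of_gaugeInvariantBootstrap_suN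
    {ψ : C(GaugeConfig d L (Matrix.specialUnitaryGroup (Fin N) ℂ), ℝ) →ₗ[ℝ] ℝ} (h1 : ψ 1 = 1)
    (hpos : ∀ a ∈ polyAlgebra (ι := Edge d L) (fundamentalLatticeRep N), 0 ≤ ψ (gaugeAvgL d L _ (a * a)))
    (hψ : IsSDFunctional (fundamentalLatticeRep N) (suExp N) (fun _ => wilsonAction (fundamentalRep (Fin N))) β
      (ψ ∘ₗ gaugeAvgL d L _))
    (x : Site d L) {w : Word d} (hw : Word.endpoint x w = x) : ψ (loopIm (fundamentalLatticeRep N) x w) = 0 := by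
  rw [eq_wilson_of_gaugeInvariantBootstrap_suN N β h1 hpos hψ (loopIm_mem _ x w) (isGaugeInvariant_loopIm _ x hw),
    wilson_loopIm_eq_zero_suN]

end Bootstrap

end Summit.QuantumFields.GaugeBoot

end
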